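import Literature.Probability.LatticeModels.CurrentExplorationWeights
import Literature.Probability.LatticeModels.AizenmanWickBound
import HarnessLib

/-!
# Aizenman 1982, Proposition 12.1 via random walks, I: one ordering, and the sum over orderings

Topic `Literature/Probability/LatticeModels`, namespace `Literature.Probability.LatticeModels`.
First half of the discharge of the named fact `aizenman_wickDeviation_le_finite` of
`AizenmanWickBound.lean` (M. Aizenman, *Geometric analysis of `φ⁴` fields and Ising models*,
Comm. Math. Phys. **86** (1982), Prop. 12.1, upper bound of (12.3): `|S_{2n} - G_{2n}| ≤ (3/2) R_{2n}`),
following the printed proof (§12, pp. 37–38, (12.5)–(12.7)) through the random-walk representation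
of §9, realised by the deterministic exploration of `CurrentExploration.lean` /
`CurrentExplorationWeights.lean`. This file contains the current-sum estimates (Parts A–B); the
combinatorial conversion to `wickRemainder`, the coincident points and the discharge itself are in
the sequel `AizenmanWickBoundProofs.lean`.

* Part A (one ordering of the points). For an ordering `τ` of the `2k` (distinct) points, pair the
  consecutive points, orient each pair by index, and explore the `j`-th independent current (sources
  the `j`-th pair) from its lower point to its higher point. By locality and the weight factorisation
  (Prop. 9.2/9.3, Lemma 9.2) and super-multiplicativity (Lemma 9.3, (9.12)), the tuples of walks with
  pairwise disjoint touched sets ("compatible") contribute at most `Z^{k-1}` times the weight of the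
  joint cylinder inside `{∂n = A}`; the other tuples have two walks whose touched sets meet, hence two
  clusters which meet, which costs `Z² |U₄|/2` for that pair of pairs (Prop. 5.1 (5.2), Prop. 9.1):
  `prod_ecurrentSum_pair_mul_le` — the current form of (12.5)–(12.7) for one `τ`.
* Part B (summing over orderings). A current lies in the joint cylinder of a compatible tuple for at
  most the `2ᵏ k!` orderings inducing one and the same pairing (locality + target change determine the
  pairing from the current): `sum_sum_good_Jsum_le`.

## References

* M. Aizenman, Comm. Math. Phys. 86 (1982) 1–48: Prop. 5.1 (5.2), §9 (Prop. 9.1–9.3, Lemmas 9.1–9.3,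
  (9.12)–(9.16)), §12 Prop. 12.1 and its proof (12.5)–(12.7) [AizenmanCMP1982].
* M. Aizenman, CDM 2020 (arXiv:2112.04248), Prop. 7.2 [AizenmanCDM2020]; R. Panis, arXiv:2309.05797,
  Prop. 4.6, Prop. 4.7 [Panis2023Triviality].
-/

noncomputable section

open MeasureTheory Finset
open scoped symmDiff ENNReal Nat

namespace Literature.Probability.LatticeModels

variable {V : Type*} [Fintype V] [DecidableEq V] {G : SimpleGraph V} [DecidableRel G.Adj]

open Current

/-! ### Part A. One ordering of the points -/

section PartA

variable (K : G.edgeFinset → ℝ) (rk : G.edgeFinset → ℕ) {k : ℕ} (x : Fin (2 * k) → V)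
  (τ : Equiv.Perm (Fin (2 * k)))

/-- The lower index of the `j`-th pair of the ordering `τ`. [folklore] -/
def loIdx (j : Fin k) : Fin (2 * k) := min (τ (pairIdx k (j, 0))) (τ (pairIdx k (j, 1)))

/-- The higher index of the `j`-th pair of the ordering `τ`. [folklore] -/
def hiIdx (j : Fin k) : Fin (2 * k) := max (τ (pairIdx k (j, 0))) (τ (pairIdx k (j, 1)))

/-- The start of the `j`-th walk: the point of lower index of the `j`-th pair ("the one with the lowest
index", Aizenman 1982, §9, p. 24). [cite: AizenmanCMP1982, §9 (p. 24–25, construction before Def. 9.2)] -/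
def wA (j : Fin k) : V := x (loIdx τ j)

/-- The target of the `j`-th walk: the point of higher index of the `j`-th pair. [cite: AizenmanCMP1982, §9 (p. 24–25)] -/
def wB (j : Fin k) : V := x (hiIdx τ j)

/-- The source set `{a_j} ∆ {b_j}` of the `j`-th independent current. [folklore] -/
def pairSrc (j : Fin k) : Finset V := {wA x τ j} ∆ {wB x τ j}

/-- The walk of the `j`-th pair read on the current `m`: exploration from `a_j` with target `{b_j}`. [cite: AizenmanCMP1982, §9 (i)–(iv)] -/
def walkOf (j : Fin k) (m : Current G) : XState G := explore rk m {wB x τ j} (wA x τ j)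

/-- The weight of the currents with sources the `j`-th pair whose walk is `δ`
(`⟨σ_aσ_b⟩ Prob(ω) Z = ρ(ω) Z`, Aizenman 1982, Prop. 9.2). [cite: AizenmanCMP1982, Prop. 9.2] -/
def Wsum (j : Fin k) (δ : XState G) : ℝ≥0∞ :=
  ∑' m : Current G, if m.sources = pairSrc x τ j ∧ walkOf rk x τ j m = δ then m.eweight K else 0

/-- **Compatible tuples of walks** (Aizenman 1982, Def. 9.2, in the form used here): each `δ_j` is the
walk of some current and ends at its target, and the touched sets are pairwise disjoint. [cite: AizenmanCMP1982, Def. 9.2] -/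
def Good (δ : Fin k → XState G) : Prop :=
  (∀ j, (∃ m : Current G, walkOf rk x τ j m = δ j) ∧ (δ j).pos = wB x τ j) ∧
    ∀ j j', j ≠ j' → Disjoint (δ j).tch (δ j').tch

/-- The weight of the joint cylinder of a tuple of walks inside `{∂n = oddSupport x}`. [folklore] -/
def Jsum (δ : Fin k → XState G) : ℝ≥0∞ :=
  ∑' m : Current G, if m.sources = oddSupport x ∧ ∀ j, InCyl (δ j) m then m.eweight K else 0

variable {x τ} in
/-- The two indices of a pair are different. [folklore] -/
theorem apply_pairIdx_zero_ne (j : Fin k) : τ (pairIdx k (j, 0)) ≠ τ (pairIdx k (j, 1)) := by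
  intro h
  have := (pairIdx k).injective (τ.injective h)
  simp at this

variable {x τ} in
/-- `loIdx < hiIdx`. [folklore] -/
theorem loIdx_lt_hiIdx (j : Fin k) : loIdx τ j < hiIdx τ j := by
  unfold loIdx hiIdx
  rcases lt_or_gt_of_ne (apply_pairIdx_zero_ne (τ := τ) j) with h | h
  · rw [min_eq_left h.le, max_eq_right h.le]; exact h
  · rw [min_eq_right h.le, max_eq_left h.le]; exact h

variable {x τ} in
/-- `{loIdx, hiIdx} = {τ(2j), τ(2j+1)}`. [folklore] -/
theorem loIdx_hiIdx_eq (j : Fin k) :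
    (loIdx τ j = τ (pairIdx k (j, 0)) ∧ hiIdx τ j = τ (pairIdx k (j, 1))) ∨
      (loIdx τ j = τ (pairIdx k (j, 1)) ∧ hiIdx τ j = τ (pairIdx k (j, 0))) := by
  unfold loIdx hiIdx
  rcases le_total (τ (pairIdx k (j, 0))) (τ (pairIdx k (j, 1))) with h | h
  · exact Or.inl ⟨min_eq_left h, max_eq_right h⟩
  · exact Or.inr ⟨min_eq_right h, max_eq_left h⟩

omit [Fintype V] [DecidableEq V] in
variable {x τ} in
/-- For distinct points the two ends of a pair are different sites. [folklore] -/
theorem wA_ne_wB (hx : Function.Injective x) (j : Fin k) : wA x τ j ≠ wB x τ j := fun h =>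
  (loIdx_lt_hiIdx (τ := τ) j).ne (hx h)

variable {x τ} in
/-- The source set of a pair does not depend on its orientation. [folklore] -/
theorem pairSrc_eq (j : Fin k) : pairSrc x τ j = {x (τ (pairIdx k (j, 0)))} ∆ {x (τ (pairIdx k (j, 1)))} := by
  unfold pairSrc wA wB
  rcases loIdx_hiIdx_eq (τ := τ) j with ⟨h0, h1⟩ | ⟨h0, h1⟩
  · rw [h0, h1]
  · rw [h0, h1, symmDiff_comm]

variable {K rk x τ}

/-- `∑_δ Wsum_j(δ) = Z[{a_j} ∆ {b_j}]`. [cite: AizenmanCMP1982, Lemma 9.1 (∑_ω θ(ω,n) q(ω) = 1)] -/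
theorem sum_Wsum (j : Fin k) : ∑ δ, Wsum K rk x τ j δ = ecurrentSum K (pairSrc x τ j) := by
  unfold Wsum ecurrentSum
  rw [← Summable.tsum_finsetSum (fun _ _ => ENNReal.summable)]
  refine tsum_congr fun m => ?_
  by_cases hs : m.sources = pairSrc x τ j
  · rw [if_pos hs]
    have h1 : ∀ δ, (if m.sources = pairSrc x τ j ∧ walkOf rk x τ j m = δ then m.eweight K else 0) =
        if walkOf rk x τ j m = δ then m.eweight K else 0 := fun δ => by
      by_cases h : walkOf rk x τ j m = δ <;> simp [h, hs]
    rw [Finset.sum_congr rfl fun δ _ => h1 δ, Finset.sum_ite_eq, if_pos (Finset.mem_univ _)]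
  · rw [if_neg hs]
    exact Finset.sum_eq_zero fun δ _ => if_neg fun h => hs h.1

/-- A walk of a current with sources the `j`-th pair ends at `b_j`; other states carry no weight
(Aizenman's observation, `Current.explore_done_of_sources_eq`). [cite: AizenmanCMP1982, §9 (p. 23)] -/
theorem Wsum_eq_zero_of_pos_ne (hrk : Function.Injective rk) (j : Fin k) {δ : XState G}
    (h : δ.pos ≠ wB x τ j) : Wsum K rk x τ j δ = 0 := by
  unfold Wsum
  refine ENNReal.tsum_eq_zero.mpr fun m => if_neg ?_
  rintro ⟨hs, hw⟩
  apply h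
  rw [← hw]
  exact (explore_done_of_sources_eq hrk hs).2

/-- States which are not walks carry no weight. [folklore] -/
theorem Wsum_eq_zero_of_not_exists (j : Fin k) {δ : XState G} (h : ¬ ∃ m : Current G, walkOf rk x τ j m = δ) :
    Wsum K rk x τ j δ = 0 := by
  unfold Wsum
  refine ENNReal.tsum_eq_zero.mpr fun m => if_neg ?_
  rintro ⟨-, hw⟩
  exact h ⟨m, hw⟩

/-- **Locality**: for a walk `δ = walk_j(m₀)`, the currents with walk `δ` are the currents of the
cylinder of `δ` (`Current.explore_congr`, `Current.pat_explore`). [cite: AizenmanCMP1982, §9 Lemma 9.1 and eq. (9.8)] -/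
theorem walkOf_eq_iff_inCyl (hrk : Function.Injective rk) (j : Fin k) {m₀ m : Current G} {δ : XState G}
    (h : walkOf rk x τ j m₀ = δ) : walkOf rk x τ j m = δ ↔ InCyl δ m := by
  constructor
  · rintro rfl
    exact fun e he => (pat_explore (wA x τ j) he).symm
  · intro hc
    rw [← h]
    refine explore_congr hrk fun e he => ?_
    have := hc e (by rw [← h]; exact he)
    rw [this, ← h]
    exact pat_explore (wA x τ j) he

/-- `Wsum_j(δ)` as the weight of the cylinder of `δ` inside `{∂m = {a_j} ∆ {b_j}}`. [cite: AizenmanCMP1982, Prop. 9.2] -/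
theorem Wsum_eq_tsum_inCyl (hrk : Function.Injective rk) (j : Fin k) {m₀ : Current G} {δ : XState G}
    (h : walkOf rk x τ j m₀ = δ) :
    Wsum K rk x τ j δ = ∑' m : Current G, if m.sources = pairSrc x τ j ∧ InCyl δ m then m.eweight K else 0 := by
  unfold Wsum
  refine tsum_congr fun m => ?_
  simp only [walkOf_eq_iff_inCyl hrk j h]

/-- **Weight factorisation of one walk** (Aizenman 1982, Prop. 9.2 / (9.8)): for a walk `δ` ending at
`b_j`, `Wsum_j(δ) = patSum K δ · Z_{K off used(δ)}[∅]`. [cite: AizenmanCMP1982, Prop. 9.2, eq. (9.8)] -/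
theorem Wsum_eq_patSum_mul (hK : ∀ e, 0 ≤ K e) (hrk : Function.Injective rk) (j : Fin k)
    {m₀ : Current G} {δ : XState G} (h : walkOf rk x τ j m₀ = δ) (hpos : δ.pos = wB x τ j) :
    Wsum K rk x τ j δ = patSum K δ * ecurrentSum (koff K δ.used) ∅ := by
  rw [Wsum_eq_tsum_inCyl hrk j h, tsum_sources_inCyl_eq hK hrk h.symm (pairSrc x τ j), hpos]
  unfold pairSrc
  rw [symmDiff_self, Finset.bot_eq_empty]

/-- In a compatible tuple, a bond used by two walks is recorded as a zero bond (its ends would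
otherwise be touched by both). [cite: AizenmanCMP1982, Def. 9.2 (compatibility)] -/
theorem pat_eq_zero_of_disjoint (hrk : Function.Injective rk) {m m' : Current G} {Y Y' : Finset V}
    {a a' : V} {δ δ' : XState G} (h : δ = explore rk m Y a) (h' : δ' = explore rk m' Y' a')
    (hd : Disjoint δ.tch δ'.tch) {e : G.edgeFinset} (he : e ∈ δ.used) (he' : e ∈ δ'.used) :
    δ.pat e = 0 := by
  subst h h'
  rw [pat_explore a he, cls_eq_zero_iff]
  by_contra hne
  obtain ⟨v, hv, hve⟩ := exists_mem_vis_of_mem_used_explore a' he'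
  exact Finset.disjoint_left.mp hd (mem_tch_of_mem_used_explore hrk a he hne hve)
    (vis_subset_tch_explore a' hv)

/-- Membership in an iterated symmetric difference is a parity condition. [folklore] -/
theorem mem_fold_symmDiff_iff {ι : Type*} [DecidableEq ι] (s : Finset ι) (B : ι → Finset V) (v : V) :
    v ∈ s.fold (fun s t : Finset V => s ∆ t) (∅ : Finset V) B ↔ Odd (s.filter fun i => v ∈ B i).card := by
  induction s using Finset.induction_on with
  | empty => simp
  | insert i s hi ih =>
    rw [Finset.fold_insert hi, Finset.mem_symmDiff, ih, Finset.filter_insert]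
    by_cases hv : v ∈ B i
    · rw [if_pos hv, Finset.card_insert_of_notMem (fun h => hi (Finset.mem_filter.mp h).1), Nat.odd_add_one]
      constructor
      · rintro (⟨-, h⟩ | ⟨-, h⟩)
        · exact h
        · exact absurd hv h
      · intro h; exact Or.inl ⟨hv, h⟩
    · rw [if_neg hv]
      constructor
      · rintro (⟨h, -⟩ | ⟨h, -⟩)
        · exact absurd h hv
        · exact h
      · intro h; exact Or.inr ⟨h, hv⟩

/-- **The pairs of an ordering partition the odd support**: `Δ_j ({a_j} ∆ {b_j}) = oddSupport x`. [folklore] -/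
theorem fold_pairSrc_eq_oddSupport :
    (Finset.univ : Finset (Fin k)).fold (fun s t : Finset V => s ∆ t) (∅ : Finset V) (pairSrc x τ) = oddSupport x := by
  ext v
  rw [mem_fold_symmDiff_iff, oddSupport, Finset.mem_filter, and_iff_right (Finset.mem_univ v)]
  -- both sides are parities of counts; compare the counts modulo two
  have hcount : (Finset.univ.filter fun i : Fin (2 * k) => x i = v).card =
      ∑ j : Fin k, ((if x (τ (pairIdx k (j, 0))) = v then 1 else 0) + (if x (τ (pairIdx k (j, 1))) = v then 1 else 0)) := by
    rw [Finset.card_filter]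
    rw [← Equiv.sum_comp τ (fun i => if x i = v then 1 else 0)]
    rw [← Equiv.sum_comp (pairIdx k) (fun q => if x (τ q) = v then 1 else 0), Fintype.sum_prod_type]
    refine Finset.sum_congr rfl fun j _ => ?_
    rw [Fin.sum_univ_two]
  have hpair : ∀ j : Fin k, (if v ∈ pairSrc x τ j then 1 else 0 : ℕ) % 2 =
      ((if x (τ (pairIdx k (j, 0))) = v then 1 else 0) + (if x (τ (pairIdx k (j, 1))) = v then 1 else 0)) % 2 := by
    intro j
    rw [pairSrc_eq]
    simp only [Finset.mem_symmDiff, Finset.mem_singleton]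
    by_cases ha : x (τ (pairIdx k (j, 0))) = v <;> by_cases hb : x (τ (pairIdx k (j, 1))) = v
    · rw [if_neg (by rintro (⟨-, h⟩ | ⟨-, h⟩) <;> [exact h hb.symm; exact h ha.symm]), if_pos ha, if_pos hb]
    · rw [if_pos (Or.inl ⟨ha.symm, fun h => hb h.symm⟩), if_pos ha, if_neg hb]
    · rw [if_pos (Or.inr ⟨hb.symm, fun h => ha h.symm⟩), if_neg ha, if_pos hb]
    · rw [if_neg (by rintro (⟨h, -⟩ | ⟨h, -⟩) <;> [exact ha h.symm; exact hb h.symm]), if_neg ha, if_neg hb]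
  rw [Nat.odd_iff, Nat.odd_iff, Finset.card_filter, Finset.sum_nat_mod, Finset.sum_congr rfl fun j _ => hpair j,
    ← Finset.sum_nat_mod, hcount]

/-- **Compatible tuples: the product of the walk weights is at most `Z^{k-1}` times the weight of the
joint cylinder** (Aizenman 1982, (9.12) `ρ(ω₁∘ω₂) ≥ ρ(ω₁)ρ(ω₂)` iterated, with Prop. 9.3: the joint
cylinder lies inside `{∂n = A}`): `(∏_j Wsum_j(δ_j)) · Z ≤ Jsum(δ) · Z^k`. [cite: AizenmanCMP1982, Lemma 9.3, eq. (9.12) and Prop. 9.3] -/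
theorem prod_Wsum_mul_le_of_good (hK : ∀ e, 0 ≤ K e) (hrk : Function.Injective rk)
    {δ : Fin k → XState G} (hgood : Good rk x τ δ) :
    (∏ j, Wsum K rk x τ j (δ j)) * ecurrentSum K ∅ ≤ Jsum K x δ * ecurrentSum K ∅ ^ k := by
  classical
  choose m hm using fun j => (hgood.1 j).1
  have hW : ∀ j, Wsum K rk x τ j (δ j) = patSum K (δ j) * ecurrentSum (koff K (δ j).used) ∅ :=
    fun j => Wsum_eq_patSum_mul hK hrk j (hm j) (hgood.1 j).2
  simp_rw [hW]
  rw [Finset.prod_mul_distrib, mul_assoc]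
  have hJ : Jsum K x δ = (∏ j, patSum K (δ j)) *
      ecurrentSum (koff K (Finset.univ.biUnion fun j => (δ j).used)) ∅ := by
    have h := tsum_sources_forall_inCyl_eq hrk Finset.univ m (fun j => {wB x τ j}) (wA x τ) δ
      (fun j _ => (hm j).symm) (fun j _ j' _ hjj' e he he' =>
        pat_eq_zero_of_disjoint hrk (hm j).symm (hm j').symm (hgood.2 j j' hjj') he he') hK (oddSupport x)
    have hfold : (Finset.univ : Finset (Fin k)).fold (fun s t : Finset V => s ∆ t) (∅ : Finset V)
        (fun j => {wA x τ j} ∆ {(δ j).pos}) = oddSupport x := by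
      rw [← fold_pairSrc_eq_oddSupport (x := x) (τ := τ)]
      congr 1
      funext j
      rw [(hgood.1 j).2]; rfl
    rw [hfold, symmDiff_self, Finset.bot_eq_empty] at h
    unfold Jsum
    simpa only [Finset.mem_univ, forall_true_left, true_implies] using h
  rw [hJ, mul_assoc]
  have h := prod_ecurrentSum_koff_mul_le hK Finset.univ fun j => (δ j).used
  rw [Finset.card_univ, Fintype.card_fin] at h
  exact mul_le_mul' le_rfl h

/-! #### The interaction of two walks -/

/-- The interaction weight of two pairs of sources: pairs of independent currents `(n, n')`,
`∂n = {a} ∆ {b}`, `∂n' = {a'} ∆ {b'}`, with `a' ∈ C_{n+n'}(a)` — the quantity `P` of the random-current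
identity `U₄ Z² = -2P` (`Current.ursellFour_currentSum_identity`; Aizenman 1982, Prop. 5.1 (5.2)). [cite: AizenmanCMP1982, Prop. 5.1, eq. (5.2)] -/
def Pint (K : G.edgeFinset → ℝ) (a b a' b' : V) : ℝ≥0∞ :=
  ∑' p : Current G × Current G,
    epairWeight K ({a} ∆ {b}) ({a'} ∆ {b'}) p * (if a' ∈ (p.1 + p.2).cluster a then 1 else 0)

/-- **Two walks whose touched sets meet cost `P`** (Aizenman 1982, (12.7) with Prop. 9.1: "a necessary
condition for the incompatibility of two paths is that the corresponding walks visit a common site",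
and then the clusters of the two independent currents meet, so that all four sources are connected in
`n + n'`): `∑_{δ,δ' : tch ∩ tch' ≠ ∅} Wsum_j(δ) Wsum_{j'}(δ') ≤ P(a_j,b_j,a_{j'},b_{j'})`. [cite: AizenmanCMP1982, eq. (12.7), Prop. 9.1 and (9.16)] -/
theorem sum_sum_Wsum_interact_le (j j' : Fin k) :
    ∑ δ, ∑ δ', (if Disjoint δ.tch δ'.tch then 0 else Wsum K rk x τ j δ * Wsum K rk x τ j' δ') ≤
      Pint K (wA x τ j) (wB x τ j) (wA x τ j') (wB x τ j') := by
  classical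
  set f : Current G → XState G → ℝ≥0∞ := fun m δ =>
    if m.sources = pairSrc x τ j ∧ walkOf rk x τ j m = δ then m.eweight K else 0 with hf
  set g : Current G → XState G → ℝ≥0∞ := fun m δ =>
    if m.sources = pairSrc x τ j' ∧ walkOf rk x τ j' m = δ then m.eweight K else 0 with hg
  set h : XState G → XState G → Current G × Current G → ℝ≥0∞ := fun δ δ' p =>
    if Disjoint δ.tch δ'.tch then 0 else f p.1 δ * g p.2 δ' with hh
  have h1 : ∀ δ δ', (if Disjoint δ.tch δ'.tch then 0 else Wsum K rk x τ j δ * Wsum K rk x τ j' δ') =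
      ∑' p : Current G × Current G, h δ δ' p := by
    intro δ δ'
    by_cases hd : Disjoint δ.tch δ'.tch
    · simp only [hh, if_pos hd, tsum_zero]
    · simp only [hh, if_neg hd]
      exact (tsum_mul_tsum_eq_tsum_prod (f := fun m => f m δ) (g := fun m => g m δ'))
  simp_rw [h1, ← Summable.tsum_finsetSum (fun _ _ => ENNReal.summable)]
  unfold Pint
  refine ENNReal.tsum_le_tsum fun p => ?_
  -- the double sum over states localises at the two walks of `p`
  have hloc : ∑ δ, ∑ δ', h δ δ' p =
      if p.1.sources = pairSrc x τ j ∧ p.2.sources = pairSrc x τ j' then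
        (if Disjoint (walkOf rk x τ j p.1).tch (walkOf rk x τ j' p.2).tch then 0
          else p.1.eweight K * p.2.eweight K) else 0 := by
    have hval : ∀ δ δ', h δ δ' p = if (walkOf rk x τ j p.1 = δ ∧ walkOf rk x τ j' p.2 = δ') then
        (if p.1.sources = pairSrc x τ j ∧ p.2.sources = pairSrc x τ j' then
          (if Disjoint δ.tch δ'.tch then 0 else p.1.eweight K * p.2.eweight K) else 0) else 0 := by
      intro δ δ'
      simp only [hh, hf, hg]
      by_cases hw : walkOf rk x τ j p.1 = δ <;> by_cases hw' : walkOf rk x τ j' p.2 = δ' <;>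
        by_cases hs : p.1.sources = pairSrc x τ j <;> by_cases hs' : p.2.sources = pairSrc x τ j' <;>
        by_cases hd : Disjoint δ.tch δ'.tch <;> simp [hw, hw', hs, hs', hd]
    simp_rw [hval]
    rw [Finset.sum_eq_single (walkOf rk x τ j p.1) (fun δ _ hδ => Finset.sum_eq_zero fun δ' _ =>
      if_neg fun hc => hδ hc.1.symm) (fun hc => absurd (Finset.mem_univ _) hc)]
    rw [Finset.sum_eq_single (walkOf rk x τ j' p.2) (fun δ' _ hδ' => if_neg fun hc => hδ' hc.2.symm)
      (fun hc => absurd (Finset.mem_univ _) hc), if_pos ⟨rfl, rfl⟩]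
  rw [hloc]
  unfold epairWeight
  by_cases hs : p.1.sources = pairSrc x τ j ∧ p.2.sources = pairSrc x τ j'
  · have hs' : p.1.sources = {wA x τ j} ∆ {wB x τ j} ∧ p.2.sources = {wA x τ j'} ∆ {wB x τ j'} := hs
    rw [if_pos hs, if_pos hs']
    by_cases hd : Disjoint (walkOf rk x τ j p.1).tch (walkOf rk x τ j' p.2).tch
    · rw [if_pos hd]; exact zero_le
    · rw [if_neg hd, if_pos]
      · rw [mul_one]
      -- the touched sets meet, hence the clusters meet
      obtain ⟨v, hv, hv'⟩ := Finset.not_disjoint_iff.mp hd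
      have hv1 : v ∈ p.1.cluster (wA x τ j) := tch_explore_subset_cluster (wA x τ j) hv
      have hv2 : v ∈ p.2.cluster (wA x τ j') := tch_explore_subset_cluster (wA x τ j') hv'
      have h12 : v ∈ (p.1 + p.2).cluster (wA x τ j) := cluster_mono le_self_add _ hv1
      have h22 : v ∈ (p.1 + p.2).cluster (wA x τ j') := cluster_mono le_add_self _ hv2
      exact mem_cluster_trans h12 (mem_cluster_comm.mp h22)
  · have hs' : ¬ (p.1.sources = {wA x τ j} ∆ {wB x τ j} ∧ p.2.sources = {wA x τ j'} ∆ {wB x τ j'}) := hs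
    rw [if_neg hs, if_neg hs', zero_mul]

/-! #### Splitting the sum over tuples of states -/

/-- The two coordinates `j ≠ j'` of a tuple, as a pair. [folklore] -/
def pairCoordEquiv {X : Type*} {j j' : Fin k} (hjj' : j ≠ j') :
    ({i : Fin k // i = j ∨ i = j'} → X) ≃ X × X where
  toFun u := (u ⟨j, Or.inl rfl⟩, u ⟨j', Or.inr rfl⟩)
  invFun q i := if i.1 = j then q.1 else q.2
  left_inv u := by
    funext i
    rcases i with ⟨i, hi | hi⟩
    · subst hi; simp
    · subst hi; simp [hjj'.symm]
  right_inv q := by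
    ext
    · simp
    · simp [hjj'.symm]

/-- **Splitting a sum over tuples along two coordinates**: a summand which is a function of the
coordinates `j, j'` times a product over the other coordinates. [folklore] -/
theorem sum_pi_pair_mul_prod_eq {X : Type*} [Fintype X] {j j' : Fin k} (hjj' : j ≠ j')
    (F : X → X → ℝ≥0∞) (W : Fin k → X → ℝ≥0∞) :
    ∑ δ : Fin k → X, F (δ j) (δ j') * ∏ i ∈ (Finset.univ.erase j).erase j', W i (δ i) =
      (∑ a, ∑ b, F a b) * ∏ i ∈ (Finset.univ.erase j).erase j', ∑ c, W i c := by
  classical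
  set p : Fin k → Prop := fun i => i = j ∨ i = j' with hp
  have hS : ∀ i, i ∈ (Finset.univ.erase j).erase j' ↔ ¬ p i := fun i => by
    simp only [Finset.mem_erase, Finset.mem_univ, and_true, hp, not_or]; tauto
  have hprod : ∀ (ψ : Fin k → ℝ≥0∞), ∏ i ∈ (Finset.univ.erase j).erase j', ψ i = ∏ i : {i // ¬ p i}, ψ i :=
    fun ψ => Finset.prod_subtype _ hS ψ
  set e := Equiv.piEquivPiSubtypeProd p (fun _ => X) with he
  rw [← Equiv.sum_comp e.symm, Fintype.sum_prod_type]
  have hterm : ∀ (u : {i // p i} → X) (v : {i // ¬ p i} → X),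
      F (e.symm (u, v) j) (e.symm (u, v) j') * ∏ i ∈ (Finset.univ.erase j).erase j', W i (e.symm (u, v) i) =
        F (u ⟨j, Or.inl rfl⟩) (u ⟨j', Or.inr rfl⟩) * ∏ i : {i // ¬ p i}, W i (v i) := by
    intro u v
    rw [hprod]
    have hj : e.symm (u, v) j = u ⟨j, Or.inl rfl⟩ := by
      simp [he, Equiv.piEquivPiSubtypeProd, hp]
    have hj' : e.symm (u, v) j' = u ⟨j', Or.inr rfl⟩ := by
      simp [he, Equiv.piEquivPiSubtypeProd, hp]
    rw [hj, hj']
    congr 1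
    refine Finset.prod_congr rfl fun i _ => ?_
    have : e.symm (u, v) i = v i := by
      have hi := i.2
      simp [he, Equiv.piEquivPiSubtypeProd, hi]
    rw [this]
  simp_rw [hterm]
  have hF : ∑ u : {i // p i} → X, F (u ⟨j, Or.inl rfl⟩) (u ⟨j', Or.inr rfl⟩) = ∑ a, ∑ b, F a b := by
    rw [← Fintype.sum_prod_type']
    exact Equiv.sum_comp (pairCoordEquiv (X := X) hjj') (fun q => F q.1 q.2)
  have hWsum : ∑ v : {i // ¬ p i} → X, ∏ i, W i.1 (v i) = ∏ i : {i // ¬ p i}, ∑ c, W i.1 c := by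
    rw [Finset.prod_univ_sum, Fintype.piFinset_univ]
  simp_rw [← Finset.mul_sum]
  rw [← Finset.sum_mul, hF, hWsum, hprod (fun i => ∑ c, W i c)]

/-! #### Assembly for one ordering -/

open Classical in
/-- **The random-current form of (12.5)–(12.7) for one ordering of the points** (Aizenman 1982, proof
of Prop. 12.1 (i)): for distinct points and an ordering `τ`, with `Z_j = Z[{a_j} ∆ {b_j}]`,
`(∏_j Z_j) · Z ≤ Z^k · ∑_{compatible δ} Jsum(δ) + Z · ∑_{j<j'} (∏_{i ≠ j,j'} Z_i) · P(a_j,b_j,a_{j'},b_{j'})`: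
split `∏_j Z_j = ∑_δ ∏_j Wsum_j(δ_j)` over tuples of walks; compatible tuples are bounded by
`prod_Wsum_mul_le_of_good`, the others have two interacting walks (`sum_sum_Wsum_interact_le`).
[cite: AizenmanCMP1982, proof of Prop. 12.1, (12.5)–(12.7)] -/
theorem prod_ecurrentSum_pair_mul_le (hK : ∀ e, 0 ≤ K e) (hrk : Function.Injective rk) :
    (∏ j, ecurrentSum K (pairSrc x τ j)) * ecurrentSum K ∅ ≤
      ecurrentSum K ∅ ^ k * (∑ δ : Fin k → XState G, if Good rk x τ δ then Jsum K x δ else 0) +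
        ecurrentSum K ∅ * ∑ j, ∑ j' ∈ Finset.univ.filter (fun j' => j < j'),
          (∏ i ∈ (Finset.univ.erase j).erase j', ecurrentSum K (pairSrc x τ i)) *
            Pint K (wA x τ j) (wB x τ j) (wA x τ j') (wB x τ j') := by
  set Z := ecurrentSum K ∅ with hZ
  set W := Wsum K rk x τ with hW
  -- `∏ Z_j = ∑_δ ∏_j W_j(δ_j)`
  have hsplit : ∏ j, ecurrentSum K (pairSrc x τ j) = ∑ δ : Fin k → XState G, ∏ j, W j (δ j) := by
    simp_rw [← sum_Wsum (K := K) (rk := rk)]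
    rw [Finset.prod_univ_sum, Fintype.piFinset_univ]
  -- termwise bound
  set T : (Fin k → XState G) → ℝ≥0∞ := fun δ =>
    (if Good rk x τ δ then Jsum K x δ * Z ^ k else 0) +
      Z * ∑ j, ∑ j' ∈ Finset.univ.filter (fun j' => j < j'),
        (if Disjoint (δ j).tch (δ j').tch then 0 else ∏ i, W i (δ i)) with hT
  have hterm : ∀ δ : Fin k → XState G, (∏ j, W j (δ j)) * Z ≤ T δ := by
    intro δ
    by_cases hg : Good rk x τ δ
    · refine le_trans ?_ (le_self_add)
      rw [if_pos hg]
      exact prod_Wsum_mul_le_of_good hK hrk hg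
    · by_cases h0 : ∃ j, W j (δ j) = 0
      · obtain ⟨j, hj⟩ := h0
        rw [Finset.prod_eq_zero (Finset.mem_univ j) hj, zero_mul]; exact zero_le
      · push Not at h0
        -- every walk exists and ends at its target, so two of them interact
        have hex : ∀ j, (∃ m : Current G, walkOf rk x τ j m = δ j) ∧ (δ j).pos = wB x τ j := by
          intro j
          refine ⟨?_, ?_⟩
          · by_contra hc; exact h0 j (Wsum_eq_zero_of_not_exists j hc)
          · by_contra hc; exact h0 j (Wsum_eq_zero_of_pos_ne hrk j hc)
        have hnd : ∃ j j', j < j' ∧ ¬ Disjoint (δ j).tch (δ j').tch := by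
          by_contra hc
          push Not at hc
          refine hg ⟨hex, fun j j' hjj' => ?_⟩
          rcases lt_or_gt_of_ne hjj' with hlt | hlt
          · exact hc j j' hlt
          · exact (hc j' j hlt).symm
        obtain ⟨j, j', hlt, hnd⟩ := hnd
        refine le_trans ?_ le_add_self
        rw [mul_comm]
        refine mul_le_mul' le_rfl ?_
        refine le_trans ?_ (Finset.single_le_sum (f := fun j => ∑ j' ∈ Finset.univ.filter (fun j' => j < j'),
          (if Disjoint (δ j).tch (δ j').tch then 0 else ∏ i, W i (δ i))) (fun _ _ => zero_le) (Finset.mem_univ j))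
        refine le_trans ?_ (Finset.single_le_sum (f := fun j' =>
          (if Disjoint (δ j).tch (δ j').tch then 0 else ∏ i, W i (δ i))) (fun _ _ => zero_le)
          (Finset.mem_filter.mpr ⟨Finset.mem_univ j', hlt⟩))
        rw [if_neg hnd]
  -- sum the termwise bounds
  rw [hsplit, Finset.sum_mul]
  refine (Finset.sum_le_sum fun δ _ => hterm δ).trans ?_
  rw [hT]
  simp only [Finset.sum_add_distrib]
  refine add_le_add (le_of_eq ?_) ?_
  · rw [Finset.mul_sum]
    refine Finset.sum_congr rfl fun δ _ => ?_
    split_ifs <;> simp [mul_comm]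
  · rw [← Finset.mul_sum]
    refine mul_le_mul' le_rfl ?_
    rw [Finset.sum_comm]
    refine Finset.sum_le_sum fun j _ => ?_
    rw [Finset.sum_comm]
    refine Finset.sum_le_sum fun j' hj' => ?_
    have hjj' : j ≠ j' := (Finset.mem_filter.mp hj').2.ne
    have hrw : ∀ δ : Fin k → XState G, (if Disjoint (δ j).tch (δ j').tch then 0 else ∏ i, W i (δ i)) =
        (if Disjoint (δ j).tch (δ j').tch then 0 else W j (δ j) * W j' (δ j')) *
          ∏ i ∈ (Finset.univ.erase j).erase j', W i (δ i) := by
      intro δ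
      rw [← Finset.mul_prod_erase _ _ (Finset.mem_univ j),
        ← Finset.mul_prod_erase _ _ (Finset.mem_erase.mpr ⟨hjj'.symm, Finset.mem_univ j'⟩), ← mul_assoc]
      split_ifs <;> simp
    simp_rw [hrw]
    rw [sum_pi_pair_mul_prod_eq hjj' (fun a b => if Disjoint a.tch b.tch then 0 else W j a * W j' b)
      (fun i c => W i c)]
    simp_rw [hW, sum_Wsum]
    rw [mul_comm]
    exact mul_le_mul' le_rfl (sum_sum_Wsum_interact_le j j')

end PartA

/-! ### Part B. Summing over the orderings: a current determines the pairing -/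

section PartB

variable {K : G.edgeFinset → ℝ} {rk : G.edgeFinset → ℕ} {k : ℕ} {x : Fin (2 * k) → V}

/-- Flipping the last bit of the block decomposition `Fin (2k) ≃ Fin k × Fin 2`. [folklore] -/
def flipIdx (k : ℕ) : Fin (2 * k) ≃ Fin (2 * k) :=
  (pairIdx k).symm.trans ((Equiv.prodCongr (Equiv.refl (Fin k)) (Equiv.swap 0 1)).trans (pairIdx k))

/-- `flipIdx` on a block. [folklore] -/
theorem flipIdx_pairIdx_zero (j : Fin k) : flipIdx k (pairIdx k (j, 0)) = pairIdx k (j, 1) := by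
  simp [flipIdx]

/-- `flipIdx` on a block. [folklore] -/
theorem flipIdx_pairIdx_one (j : Fin k) : flipIdx k (pairIdx k (j, 1)) = pairIdx k (j, 0) := by
  simp [flipIdx, Equiv.swap_apply_right]

/-- The pairPartner of an index under the pairing induced by the ordering `τ`
(`τ(2j) ↔ τ(2j+1)`). [folklore] -/
def pairPartner (τ : Equiv.Perm (Fin (2 * k))) : Fin (2 * k) → Fin (2 * k) := fun i => τ (flipIdx k (τ.symm i))

/-- The pairPartner of `τ(2j)` is `τ(2j+1)`. [folklore] -/
theorem pairPartner_apply_zero (τ : Equiv.Perm (Fin (2 * k))) (j : Fin k) :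
    pairPartner τ (τ (pairIdx k (j, 0))) = τ (pairIdx k (j, 1)) := by
  simp [pairPartner, flipIdx_pairIdx_zero]

/-- The pairPartner of `τ(2j+1)` is `τ(2j)`. [folklore] -/
theorem pairPartner_apply_one (τ : Equiv.Perm (Fin (2 * k))) (j : Fin k) :
    pairPartner τ (τ (pairIdx k (j, 1))) = τ (pairIdx k (j, 0)) := by
  simp [pairPartner, flipIdx_pairIdx_one]

/-- Every index lies in a block. [folklore] -/
theorem exists_eq_apply_pairIdx (τ : Equiv.Perm (Fin (2 * k))) (i : Fin (2 * k)) :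
    ∃ j : Fin k, i = τ (pairIdx k (j, 0)) ∨ i = τ (pairIdx k (j, 1)) := by
  obtain ⟨⟨j, c⟩, hq⟩ := (pairIdx k).surjective (τ.symm i)
  refine ⟨j, ?_⟩
  have hi : i = τ (pairIdx k (j, c)) := by rw [hq, Equiv.apply_symm_apply]
  rcases Fin.exists_fin_two.mp ⟨c, rfl⟩ with h | h
  · exact Or.inl (by rw [hi, h])
  · exact Or.inr (by rw [hi, h])

/-- `pairPartner` is an involution. [folklore] -/
theorem pairPartner_pairPartner (τ : Equiv.Perm (Fin (2 * k))) (i : Fin (2 * k)) : pairPartner τ (pairPartner τ i) = i := by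
  obtain ⟨j, h | h⟩ := exists_eq_apply_pairIdx τ i <;> rw [h]
  · rw [pairPartner_apply_zero, pairPartner_apply_one]
  · rw [pairPartner_apply_one, pairPartner_apply_zero]

/-- No index is its own pairPartner. [folklore] -/
theorem pairPartner_ne (τ : Equiv.Perm (Fin (2 * k))) (i : Fin (2 * k)) : pairPartner τ i ≠ i := by
  obtain ⟨j, h | h⟩ := exists_eq_apply_pairIdx τ i <;> rw [h]
  · rw [pairPartner_apply_zero]; exact (apply_pairIdx_zero_ne (τ := τ) j).symm
  · rw [pairPartner_apply_one]; exact apply_pairIdx_zero_ne (τ := τ) j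

/-- The oriented pair of a block in terms of `pairPartner`. [folklore] -/
theorem loIdx_hiIdx_of_eq (τ : Equiv.Perm (Fin (2 * k))) {i : Fin (2 * k)} {j : Fin k}
    (h : i = τ (pairIdx k (j, 0)) ∨ i = τ (pairIdx k (j, 1))) :
    loIdx τ j = min i (pairPartner τ i) ∧ hiIdx τ j = max i (pairPartner τ i) := by
  rcases h with h | h <;> rw [h]
  · rw [pairPartner_apply_zero]; exact ⟨rfl, rfl⟩
  · rw [pairPartner_apply_one, min_comm, max_comm]; exact ⟨rfl, rfl⟩

variable (rk x) in
/-- **Admissible orderings for a current**: every walk of the ordering read on `m` ends at its target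
and the touched sets are pairwise disjoint (the condition a current in the joint cylinder of a
compatible tuple satisfies, `adm_of_good_of_inCyl`). [cite: AizenmanCMP1982, Def. 9.2] -/
def Adm (τ : Equiv.Perm (Fin (2 * k))) (m : Current G) : Prop :=
  (∀ j, (walkOf rk x τ j m).pos = wB x τ j) ∧
    ∀ j j', j ≠ j' → Disjoint (walkOf rk x τ j m).tch (walkOf rk x τ j' m).tch

/-- A current in the joint cylinder of a compatible tuple is admissible, and the tuple is the tuple of
its walks (locality). [cite: AizenmanCMP1982, Lemma 9.1 and Def. 9.2] -/
theorem adm_of_good_of_inCyl (hrk : Function.Injective rk) {τ : Equiv.Perm (Fin (2 * k))}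
    {δ : Fin k → XState G} {m : Current G} (hg : Good rk x τ δ) (hc : ∀ j, InCyl (δ j) m) :
    Adm rk x τ m ∧ δ = fun j => walkOf rk x τ j m := by
  have hw : ∀ j, walkOf rk x τ j m = δ j := fun j => by
    obtain ⟨m₀, hm₀⟩ := (hg.1 j).1
    exact (walkOf_eq_iff_inCyl hrk j hm₀).mpr (hc j)
  refine ⟨⟨fun j => by rw [hw j]; exact (hg.1 j).2, fun j j' hjj' => by rw [hw j, hw j']; exact hg.2 j j' hjj'⟩, ?_⟩
  funext j; exact (hw j).symm

/-- Both points of every pair are touched by its walk (the start is visited, the target is the final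
site of an admissible walk). [folklore] -/
theorem apply_mem_tch_walkOf (τ : Equiv.Perm (Fin (2 * k))) {m : Current G} (hadm : Adm rk x τ m)
    {q : Fin (2 * k)} {j : Fin k} (hq : q = τ (pairIdx k (j, 0)) ∨ q = τ (pairIdx k (j, 1))) :
    x q ∈ (walkOf rk x τ j m).tch := by
  obtain ⟨hlo, hhi⟩ := loIdx_hiIdx_of_eq τ hq
  rcases le_total q (pairPartner τ q) with hle | hle
  · -- `q` is the start
    have : wA x τ j = x q := by rw [wA, hlo, min_eq_left hle]
    rw [← this]
    exact vis_subset_tch_explore _ (start_mem_vis_explore (wA x τ j))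
  · -- `q` is the target, reached by admissibility
    have : wB x τ j = x q := by rw [wB, hhi, max_eq_left hle]
    rw [← this, ← hadm.1 j]
    exact vis_subset_tch_explore _ (pos_mem_vis_explore (wA x τ j))

/-- **A current determines the pairing of an admissible ordering** (the pairing is read off the current
by the walks from the successive lowest unpaired indices: locality `Current.explore_congr` and the
target change `Current.explore_target_congr`): two admissible orderings of the same current induce the
same pairPartner map. [cite: AizenmanCMP1982, §9 (construction p. 24–25) and Prop. 9.3] -/
theorem pairPartner_eq_of_adm (hx : Function.Injective x) {τ τ' : Equiv.Perm (Fin (2 * k))} {m : Current G}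
    (h : Adm rk x τ m) (h' : Adm rk x τ' m) : pairPartner τ = pairPartner τ' := by
  -- strong induction on the index
  suffices H : ∀ n : ℕ, ∀ i : Fin (2 * k), (i : ℕ) = n → pairPartner τ i = pairPartner τ' i by
    funext i; exact H i i rfl
  intro n
  induction n using Nat.strong_induction_on with
  | _ n ih =>
    intro i hi
    -- an index paired below `i` by one ordering is paired the same way by the other
    have hlow : ∀ {ρ ρ' : Equiv.Perm (Fin (2 * k))}, (∀ i' : Fin (2 * k), (i' : ℕ) < n → pairPartner ρ i' = pairPartner ρ' i') →
        pairPartner ρ i < i → pairPartner ρ' i = pairPartner ρ i := by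
      intro ρ ρ' hih hlt
      have h1 := hih (pairPartner ρ i) (by rw [← hi]; exact hlt)
      rw [pairPartner_pairPartner] at h1
      have h2 := congrArg (pairPartner ρ') h1
      rw [pairPartner_pairPartner] at h2
      exact h2
    have ih' : ∀ i' : Fin (2 * k), (i' : ℕ) < n → pairPartner τ i' = pairPartner τ' i' := fun i' hi' => ih i' hi' i' rfl
    by_cases hlt : pairPartner τ i < i
    · exact (hlow ih' hlt).symm
    by_cases hlt' : pairPartner τ' i < i
    · exact hlow (fun i' hi' => (ih' i' hi').symm) hlt'
    -- `i` is the lower point of its pair in both orderings: compare the two walks from `x i`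
    have hgt : i < pairPartner τ i := lt_of_le_of_ne (not_lt.mp hlt) (pairPartner_ne τ i).symm
    have hgt' : i < pairPartner τ' i := lt_of_le_of_ne (not_lt.mp hlt') (pairPartner_ne τ' i).symm
    obtain ⟨j, hj⟩ := exists_eq_apply_pairIdx τ i
    obtain ⟨j', hj'⟩ := exists_eq_apply_pairIdx τ' i
    obtain ⟨hlo, hhi⟩ := loIdx_hiIdx_of_eq τ hj
    obtain ⟨hlo', hhi'⟩ := loIdx_hiIdx_of_eq τ' hj'
    rw [min_eq_left hgt.le] at hlo; rw [max_eq_right hgt.le] at hhi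
    rw [min_eq_left hgt'.le] at hlo'; rw [max_eq_right hgt'.le] at hhi'
    have hwA : wA x τ j = x i := by rw [wA, hlo]
    have hwB : wB x τ j = x (pairPartner τ i) := by rw [wB, hhi]
    have hwA' : wA x τ' j' = x i := by rw [wA, hlo']
    have hwB' : wB x τ' j' = x (pairPartner τ' i) := by rw [wB, hhi']
    -- a walk never sits at a point of another pair
    have hkey : ∀ {ρ : Equiv.Perm (Fin (2 * k))} {jρ : Fin k} (hadm : Adm rk x ρ m)
        (hiρ : i = ρ (pairIdx k (jρ, 0)) ∨ i = ρ (pairIdx k (jρ, 1))) {q : Fin (2 * k)},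
        q ≠ i → q ≠ pairPartner ρ i → ∀ l, (exploreAt rk m {wB x ρ jρ} (wA x ρ jρ) l).pos ≠ x q := by
      intro ρ jρ hadm hiρ q hqi hqp l hl
      obtain ⟨j₂, hj₂⟩ := exists_eq_apply_pairIdx ρ q
      have hne : jρ ≠ j₂ := by
        rintro rfl
        rcases hiρ with hi0 | hi1 <;> rcases hj₂ with hq0 | hq1
        · exact hqi (hq0.trans hi0.symm)
        · apply hqp; rw [hq1, hi0, pairPartner_apply_zero]
        · apply hqp; rw [hq0, hi1, pairPartner_apply_one]
        · exact hqi (hq1.trans hi1.symm)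
      have hmem : x q ∈ (walkOf rk x ρ j₂ m).tch := apply_mem_tch_walkOf ρ hadm hj₂
      have hmem' : x q ∈ (walkOf rk x ρ jρ m).tch := by
        rw [← hl]
        exact vis_subset_tch_explore _ (pos_exploreAt_mem_vis_explore' (wA x ρ jρ) l)
      exact Finset.disjoint_left.mp (hadm.2 jρ j₂ hne) hmem' hmem
    -- the two walks from `x i` coincide (target change), hence end at the same point
    have heq : explore rk m {wB x τ j} (wA x τ j) = explore rk m {wB x τ' j'} (wA x τ' j') := by
      rw [hwA, hwA']
      by_cases hpp : pairPartner τ' i = pairPartner τ i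
      · rw [hwB, hwB', hpp]
      refine explore_target_congr (fun l hl => ?_) (fun l hl => ?_)
      · exfalso
        rw [Finset.mem_singleton, hwB'] at hl
        rw [← hwA] at hl
        exact hkey h hj (pairPartner_ne τ' i) hpp l hl
      · exfalso
        rw [Finset.mem_singleton, hwB] at hl
        rw [← hwA'] at hl
        exact hkey h' hj' (pairPartner_ne τ i) (fun h => hpp h.symm) l hl
    have hfin : x (pairPartner τ i) = x (pairPartner τ' i) := by
      rw [← hwB, ← hwB', ← h.1 j, ← h'.1 j']
      exact congrArg XState.pos heq
    exact hx hfin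

/-! #### Counting the orderings with a given pairing -/

/-- The block of `τ₀` containing `τ(2j)`. [folklore] -/
def pairBlockOf (τ₀ τ : Equiv.Perm (Fin (2 * k))) (j : Fin k) : Fin k × Fin 2 := (pairIdx k).symm (τ₀.symm (τ (pairIdx k (j, 0))))

/-- `τ(2j) = τ₀(pairBlockOf j)`. [folklore] -/
theorem apply_pairIdx_zero_eq (τ₀ τ : Equiv.Perm (Fin (2 * k))) (j : Fin k) :
    τ (pairIdx k (j, 0)) = τ₀ (pairIdx k (pairBlockOf τ₀ τ j)) := by
  simp [pairBlockOf]

/-- With the same pairPartner map, `τ(2j+1) = τ₀(flipped block)`. [folklore] -/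
theorem apply_pairIdx_one_eq {τ₀ τ : Equiv.Perm (Fin (2 * k))} (h : pairPartner τ = pairPartner τ₀) (j : Fin k) :
    τ (pairIdx k (j, 1)) = τ₀ (flipIdx k (pairIdx k (pairBlockOf τ₀ τ j))) := by
  rw [← pairPartner_apply_zero τ j, h, apply_pairIdx_zero_eq τ₀ τ j, pairPartner, Equiv.symm_apply_apply]

/-- For orderings with the pairPartner map of `τ₀`, the block map is injective. [folklore] -/
theorem pairBlockOf_fst_injective {τ₀ τ : Equiv.Perm (Fin (2 * k))} (h : pairPartner τ = pairPartner τ₀) :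
    Function.Injective fun j => (pairBlockOf τ₀ τ j).1 := by
  intro j j' hjj'
  simp only at hjj'
  have h0 := apply_pairIdx_zero_eq τ₀ τ j
  have h0' := apply_pairIdx_zero_eq τ₀ τ j'
  -- compare the second components
  rcases Fin.exists_fin_two.mp ⟨(pairBlockOf τ₀ τ j).2, rfl⟩ with hc | hc <;>
    rcases Fin.exists_fin_two.mp ⟨(pairBlockOf τ₀ τ j').2, rfl⟩ with hc' | hc'
  · have : τ (pairIdx k (j, 0)) = τ (pairIdx k (j', 0)) := by
      rw [h0, h0', show pairBlockOf τ₀ τ j = pairBlockOf τ₀ τ j' from Prod.ext hjj' (hc.trans hc'.symm)]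
    have := (pairIdx k).injective (τ.injective this)
    simpa using this
  · exfalso
    have h1 := apply_pairIdx_one_eq h j
    have : flipIdx k (pairIdx k (pairBlockOf τ₀ τ j)) = pairIdx k (pairBlockOf τ₀ τ j') := by
      rw [show pairBlockOf τ₀ τ j = ((pairBlockOf τ₀ τ j).1, 0) from Prod.ext rfl hc, flipIdx_pairIdx_zero,
        show pairBlockOf τ₀ τ j' = ((pairBlockOf τ₀ τ j').1, 1) from Prod.ext rfl hc', hjj']
    rw [this, ← h0'] at h1
    have := (pairIdx k).injective (τ.injective h1)
    simp at this
  · exfalso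
    have h1 := apply_pairIdx_one_eq h j'
    have : flipIdx k (pairIdx k (pairBlockOf τ₀ τ j')) = pairIdx k (pairBlockOf τ₀ τ j) := by
      rw [show pairBlockOf τ₀ τ j' = ((pairBlockOf τ₀ τ j').1, 0) from Prod.ext rfl hc', flipIdx_pairIdx_zero,
        show pairBlockOf τ₀ τ j = ((pairBlockOf τ₀ τ j).1, 1) from Prod.ext rfl hc, hjj']
    rw [this, ← h0] at h1
    have := (pairIdx k).injective (τ.injective h1)
    simp at this
  · have : τ (pairIdx k (j, 0)) = τ (pairIdx k (j', 0)) := by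
      rw [h0, h0', show pairBlockOf τ₀ τ j = pairBlockOf τ₀ τ j' from Prod.ext hjj' (hc.trans hc'.symm)]
    have := (pairIdx k).injective (τ.injective this)
    simpa using this

/-- **At most `2ᵏ k!` orderings induce a given pairing**: an injection into
`Perm (Fin k) × (Fin k → Fin 2)` (which block of `τ₀`, in which orientation). [folklore] -/
theorem card_pairPartner_eq_le (τ₀ : Equiv.Perm (Fin (2 * k))) :
    Fintype.card {τ : Equiv.Perm (Fin (2 * k)) // pairPartner τ = pairPartner τ₀} ≤ 2 ^ k * k ! := by
  classical
  let Φ : {τ : Equiv.Perm (Fin (2 * k)) // pairPartner τ = pairPartner τ₀} → Equiv.Perm (Fin k) × (Fin k → Fin 2) :=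
    fun τ => (Equiv.ofBijective (fun j => (pairBlockOf τ₀ τ.1 j).1)
      ((Finite.injective_iff_bijective).mp (pairBlockOf_fst_injective τ.2)), fun j => (pairBlockOf τ₀ τ.1 j).2)
  have hΦ : Function.Injective Φ := by
    rintro ⟨τ, hτ⟩ ⟨τ', hτ'⟩ hΦ
    simp only [Φ, Prod.mk.injEq] at hΦ
    obtain ⟨h1, h2⟩ := hΦ
    have hb : ∀ j, pairBlockOf τ₀ τ j = pairBlockOf τ₀ τ' j := fun j =>
      Prod.ext (by simpa using congrArg (fun e => e j) (congrArg Equiv.toFun h1)) (congrFun h2 j)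
    apply Subtype.ext
    apply Equiv.ext
    intro q
    obtain ⟨⟨j, c⟩, rfl⟩ := (pairIdx k).surjective q
    rcases Fin.exists_fin_two.mp ⟨c, rfl⟩ with hc | hc <;> rw [hc]
    · rw [apply_pairIdx_zero_eq τ₀ τ j, apply_pairIdx_zero_eq τ₀ τ' j, hb j]
    · rw [apply_pairIdx_one_eq hτ j, apply_pairIdx_one_eq hτ' j, hb j]
  have := Fintype.card_le_of_injective Φ hΦ
  rw [Fintype.card_prod, Fintype.card_perm, Fintype.card_fun, Fintype.card_fin, Fintype.card_fin] at this
  exact this.trans (le_of_eq (Nat.mul_comm _ _))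

open Classical in
/-- **Summing the joint cylinders of the compatible tuples over all orderings**: each current with
sources `oddSupport x` is counted at most `2ᵏ k!` times (Aizenman 1982, Prop. 9.3: the random-walk
representation is an identity; here only the inequality `∑_T ∑_{compatible} ≤ S_{2n}` is needed).
[cite: AizenmanCMP1982, Prop. 9.3] -/
theorem sum_sum_good_Jsum_le (hrk : Function.Injective rk) (hx : Function.Injective x) :
    ∑ τ : Equiv.Perm (Fin (2 * k)), ∑ δ : Fin k → XState G, (if Good rk x τ δ then Jsum K x δ else 0) ≤
      (2 ^ k * k ! : ℝ≥0∞) * ecurrentSum K (oddSupport x) := by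
  classical
  -- exchange the sums
  have hex : ∑ τ : Equiv.Perm (Fin (2 * k)), ∑ δ : Fin k → XState G, (if Good rk x τ δ then Jsum K x δ else 0) =
      ∑' m : Current G, (if m.sources = oddSupport x then m.eweight K else 0) *
        ∑ τ : Equiv.Perm (Fin (2 * k)), ∑ δ : Fin k → XState G,
          (if Good rk x τ δ ∧ ∀ j, InCyl (δ j) m then 1 else 0) := by
    have h1 : ∀ τ (δ : Fin k → XState G), (if Good rk x τ δ then Jsum K x δ else 0) =
        ∑' m : Current G, (if m.sources = oddSupport x then m.eweight K else 0) *
          (if Good rk x τ δ ∧ ∀ j, InCyl (δ j) m then 1 else 0) := by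
      intro τ δ
      by_cases hg : Good rk x τ δ
      · rw [if_pos hg, Jsum]
        refine tsum_congr fun m => ?_
        by_cases hs : m.sources = oddSupport x <;> by_cases hc : ∀ j, InCyl (δ j) m <;> simp [hg, hs, hc]
      · rw [if_neg hg]
        simp [hg]
    simp_rw [h1, ← Summable.tsum_finsetSum (fun _ _ => ENNReal.summable), ← Finset.mul_sum]
  rw [hex]
  -- bound the multiplicity of each current
  have hmult : ∀ m : Current G, ∑ τ : Equiv.Perm (Fin (2 * k)), ∑ δ : Fin k → XState G,
      (if Good rk x τ δ ∧ ∀ j, InCyl (δ j) m then 1 else 0 : ℝ≥0∞) ≤ 2 ^ k * k ! := by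
    intro m
    have hτ : ∀ τ : Equiv.Perm (Fin (2 * k)), ∑ δ : Fin k → XState G,
        (if Good rk x τ δ ∧ ∀ j, InCyl (δ j) m then 1 else 0 : ℝ≥0∞) ≤ if Adm rk x τ m then 1 else 0 := by
      intro τ
      by_cases ha : Adm rk x τ m
      · rw [if_pos ha, ← Finset.sum_filter]
        have hsub : Finset.univ.filter (fun δ : Fin k → XState G => Good rk x τ δ ∧ ∀ j, InCyl (δ j) m) ⊆
            {fun j => walkOf rk x τ j m} := by
          intro δ hδ
          rw [Finset.mem_filter] at hδ
          rw [Finset.mem_singleton]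
          exact (adm_of_good_of_inCyl hrk hδ.2.1 hδ.2.2).2
        refine (Finset.sum_le_sum_of_subset hsub).trans ?_
        rw [Finset.sum_singleton]
      · rw [if_neg ha]
        exact le_of_eq (Finset.sum_eq_zero fun δ _ => if_neg fun hδ => ha (adm_of_good_of_inCyl hrk hδ.1 hδ.2).1)
    refine (Finset.sum_le_sum fun τ _ => hτ τ).trans ?_
    by_cases hex : ∃ τ₀ : Equiv.Perm (Fin (2 * k)), Adm rk x τ₀ m
    · obtain ⟨τ₀, hτ₀⟩ := hex
      calc ∑ τ : Equiv.Perm (Fin (2 * k)), (if Adm rk x τ m then 1 else 0 : ℝ≥0∞)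
          ≤ ∑ τ : Equiv.Perm (Fin (2 * k)), (if pairPartner τ = pairPartner τ₀ then 1 else 0 : ℝ≥0∞) :=
            Finset.sum_le_sum fun τ _ => by
              by_cases ha : Adm rk x τ m
              · rw [if_pos ha, if_pos (pairPartner_eq_of_adm hx ha hτ₀)]
              · rw [if_neg ha]; exact zero_le
        _ = (Fintype.card {τ : Equiv.Perm (Fin (2 * k)) // pairPartner τ = pairPartner τ₀} : ℝ≥0∞) := by
            rw [Finset.sum_boole, Fintype.card_subtype]
        _ ≤ 2 ^ k * k ! := by exact_mod_cast card_pairPartner_eq_le τ₀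
    · push Not at hex
      refine le_of_eq_of_le (Finset.sum_eq_zero fun τ _ => if_neg (hex τ)) zero_le
  calc ∑' m : Current G, (if m.sources = oddSupport x then m.eweight K else 0) *
        ∑ τ : Equiv.Perm (Fin (2 * k)), ∑ δ : Fin k → XState G,
          (if Good rk x τ δ ∧ ∀ j, InCyl (δ j) m then 1 else 0 : ℝ≥0∞)
      ≤ ∑' m : Current G, (if m.sources = oddSupport x then m.eweight K else 0) * (2 ^ k * k !) :=
        ENNReal.tsum_le_tsum fun m => mul_le_mul' le_rfl (hmult m)
    _ = (2 ^ k * k ! : ℝ≥0∞) * ecurrentSum K (oddSupport x) := by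
        rw [ENNReal.tsum_mul_right, mul_comm]; rfl

end PartB



end Literature.Probability.LatticeModels

end
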